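import Literature.MathematicalPhysics.QuantumLattice.WindowEntropyIncrement
import Literature.InformationTheory.Entropy.ConditionalEntropyConcavity
import HarnessLib

/-!
# The entropy antecedent of a symmetrised translation-invariant relaxation survives averaging

Level `k` of the entropy-constrained translation-invariant SDP hierarchy for a quantum chain carries
the constraint `0 ≤ S(ρ_{[1,k]}) − S(ρ_{[1,k−1]})` on the `k`-site window variable
[cite: FawziFawziScalet2024Entropy, Theorem 4.1]; when the relaxation is in addition SYMMETRISED over a
finite group `G` of symmetries of the problem acting on the window by unitary conjugation, the feasible
point fed to the by-value claim is the average `ρ̄ = |G|⁻¹ Σ_g U_g ρ U_g⋆`, and the entropy constraint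
for `ρ̄` follows from the one for each `U_g ρ U_g⋆` by the CONCAVITY OF THE CONDITIONAL ENTROPY
[cite: LiebRuskai1973, Theorem 1] [cite: NielsenChuang2010, Corollary 11.13 p.521].

This file restates the averaging corollary `vonNeumannEntropy_sub_traceRight_avg_nonneg` of
`Literature/InformationTheory/Entropy/ConditionalEntropyConcavity.lean` in the vocabulary of
`Op`/`spinPartialTrace` (`SpinPartialTrace.lean`), i.e. in the exact shape of the window antecedent:

* `entropy_sub_spinPartialTrace_inl_avg_nonneg`: on a two-block site type `K ⊕ C` (keep `K`, trace
  out `C` along `Sum.inl : K ↪ K ⊕ C`);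
* `entropy_sub_spinPartialTrace_avg_nonneg'`: on any site type `Y` identified with `K ⊕ C` by
  `ε : Y ≃ K ⊕ C`, for the sub-window embedding `φK = inl ≫ ε⁻¹` (for a chain window
  `Y = {a, …, a+k−1}`, `K` = its first `k−1` sites, `C` = the last site).

The unitary invariance `S(U ρ U⋆) = S(ρ)` needed for the individual terms is
`Literature.InformationTheory.Entropy.vonNeumannEntropy_unitary_conj`.
-/

open Matrix
open scoped BigOperators ComplexOrder

namespace Literature.MathematicalPhysics.QuantumLattice

open Literature.Computability.QuantumComplexity (traceRight IsDensity traceRight_apply)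
open Literature.InformationTheory.Entropy (vonNeumannEntropy vonNeumannEntropy_submatrix_equiv
  vonNeumannEntropy_sub_traceRight_avg_nonneg)

variable {K C : Type} [Fintype K] [DecidableEq K] [Fintype C] [DecidableEq C] {q : ℕ}

/-- The `K`-marginal along `Sum.inl : K ↪ K ⊕ C` is the partial trace over the second factor once the
configurations of `K ⊕ C` are read as pairs (`Equiv.sumArrowEquivProdArrow`).
[cite: NielsenChuang2010, §2.4.3 eq. (2.178)] -/
theorem spinPartialTrace_inl_eq_traceRight_submatrix (σ : Op (K ⊕ C) q) :
    spinPartialTrace (Function.Embedding.inl : K ↪ K ⊕ C) σ =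
      traceRight (σ.submatrix (Equiv.sumArrowEquivProdArrow K C (Fin q)).symm
        (Equiv.sumArrowEquivProdArrow K C (Fin q)).symm) := by
  ext t s
  rw [spinPartialTrace_inl_apply, traceRight_apply]
  rfl

/-- The trace is invariant under reading configurations of `K ⊕ C` as pairs. [cite: NielsenChuang2010, §2.4.3 eq. (2.178)] -/
private theorem trace_submatrix_sumArrow (σ : Op (K ⊕ C) q) :
    (σ.submatrix (Equiv.sumArrowEquivProdArrow K C (Fin q)).symm
      (Equiv.sumArrowEquivProdArrow K C (Fin q)).symm).trace = σ.trace := by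
  simp only [Matrix.trace, Matrix.diag, Matrix.submatrix_apply]
  exact (Equiv.sumArrowEquivProdArrow K C (Fin q)).symm.sum_comp (fun i => σ i i)

/-- **The window entropy antecedent survives averaging (two-block site type).** If each window state
`σ_g` (`g ∈ G`, finite, nonempty; positive semidefinite, trace one) satisfies
`0 ≤ S(σ_g) − S(tr_C σ_g)` (marginal on the first block `K` along `Sum.inl`), then so does the
average `σ̄ = |G|⁻¹ Σ_g σ_g` — concavity of the conditional entropy. Typical use: `σ_g = U_g ρ U_g⋆`
for a finite symmetry group acting by unitaries, each term reduced to `ρ`'s antecedent by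
`vonNeumannEntropy_unitary_conj` and the covariance of the partial trace.
[cite: LiebRuskai1973, Theorem 1] [cite: FawziFawziScalet2024Entropy, Theorem 4.1] -/
theorem entropy_sub_spinPartialTrace_inl_avg_nonneg {G : Type} [Fintype G] [DecidableEq G] [Nonempty G]
    (σ : G → Op (K ⊕ C) q) (hσ : ∀ g, (σ g).PosSemidef) (htr : ∀ g, (σ g).trace = 1)
    (hpos : ∀ g, 0 ≤ vonNeumannEntropy (σ g) -
      vonNeumannEntropy (spinPartialTrace (Function.Embedding.inl : K ↪ K ⊕ C) (σ g))) :
    0 ≤ vonNeumannEntropy ((Fintype.card G : ℂ)⁻¹ • ∑ g, σ g) -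
      vonNeumannEntropy (spinPartialTrace (Function.Embedding.inl : K ↪ K ⊕ C)
        ((Fintype.card G : ℂ)⁻¹ • ∑ g, σ g)) := by
  set e := (Equiv.sumArrowEquivProdArrow K C (Fin q)).symm with he
  set ρ : G → Matrix (TensorIndex K q × TensorIndex C q) (TensorIndex K q × TensorIndex C q) ℂ :=
    fun g => (σ g).submatrix e e with hρ
  have hρd : ∀ g, IsDensity (ρ g) := fun g =>
    ⟨(hσ g).submatrix e, by rw [hρ]; exact (trace_submatrix_sumArrow (σ g)).trans (htr g)⟩
  have hρpos : ∀ g, 0 ≤ vonNeumannEntropy (ρ g) - vonNeumannEntropy (traceRight (ρ g)) := by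
    intro g
    have h1 : vonNeumannEntropy (ρ g) = vonNeumannEntropy (σ g) :=
      vonNeumannEntropy_submatrix_equiv (hσ g).1 e
    have h2 : traceRight (ρ g) = spinPartialTrace (Function.Embedding.inl : K ↪ K ⊕ C) (σ g) :=
      (spinPartialTrace_inl_eq_traceRight_submatrix (σ g)).symm
    rw [h1, h2]
    exact hpos g
  have key := vonNeumannEntropy_sub_traceRight_avg_nonneg ρ hρd hρpos
  -- identify the averaged pair-indexed state with the averaged window state
  set σbar : Op (K ⊕ C) q := (Fintype.card G : ℂ)⁻¹ • ∑ g, σ g with hσbar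
  have hsub : σbar.submatrix e e = (Fintype.card G : ℂ)⁻¹ • ∑ g, ρ g := by
    ext i j
    simp only [hσbar, hρ, Matrix.submatrix_apply, Matrix.smul_apply, Matrix.sum_apply]
  have hσbar_psd : σbar.PosSemidef := by
    have hN : (0 : ℂ) ≤ (Fintype.card G : ℂ)⁻¹ := by
      rw [← Complex.ofReal_natCast, ← Complex.ofReal_inv]
      exact Complex.zero_le_real.mpr (inv_nonneg.mpr (Nat.cast_nonneg _))
    exact (Matrix.posSemidef_sum Finset.univ fun g _ => hσ g).smul hN
  have h1 : vonNeumannEntropy σbar = vonNeumannEntropy ((Fintype.card G : ℂ)⁻¹ • ∑ g, ρ g) := by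
    rw [← hsub]
    exact (vonNeumannEntropy_submatrix_equiv hσbar_psd.1 e).symm
  have h2 : spinPartialTrace (Function.Embedding.inl : K ↪ K ⊕ C) σbar =
      traceRight ((Fintype.card G : ℂ)⁻¹ • ∑ g, ρ g) := by
    rw [← hsub]
    exact spinPartialTrace_inl_eq_traceRight_submatrix σbar
  rw [h1, h2]
  exact key

/-- **The window entropy antecedent survives averaging, for a window on any site type.** Same
statement for window states on a site type `Y` identified with a two-block window by
`ε : Y ≃ K ⊕ C`, the kept sub-window being the site embedding `φK : K ↪ Y` that `ε` carries to
`Sum.inl` (hypothesis `hK`). For the level-`k` window `Y = {a, …, a+k−1}` of a chain, `K` = the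
first `k−1` sites and `C` = the last site, this is the form of the entropy antecedent in the
by-value claim node of a `G`-symmetrised ENT certificate.
[cite: LiebRuskai1973, Theorem 1] [cite: FawziFawziScalet2024Entropy, Theorem 4.1] -/
theorem entropy_sub_spinPartialTrace_avg_nonneg' {Y : Type} [Fintype Y] [DecidableEq Y]
    (ε : Y ≃ K ⊕ C) {φK : K ↪ Y}
    (hK : φK = (Function.Embedding.inl : K ↪ K ⊕ C).trans ε.symm.toEmbedding)
    {G : Type} [Fintype G] [DecidableEq G] [Nonempty G]
    (σ : G → Op Y q) (hσ : ∀ g, (σ g).PosSemidef) (htr : ∀ g, (σ g).trace = 1)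
    (hpos : ∀ g, 0 ≤ vonNeumannEntropy (σ g) - vonNeumannEntropy (spinPartialTrace φK (σ g))) :
    0 ≤ vonNeumannEntropy ((Fintype.card G : ℂ)⁻¹ • ∑ g, σ g) -
      vonNeumannEntropy (spinPartialTrace φK ((Fintype.card G : ℂ)⁻¹ • ∑ g, σ g)) := by
  -- move every `σ g` to the standard two-block window
  set σ' : G → Op (K ⊕ C) q := fun g => reindexOp ε (σ g) with hσ'
  have hre : ∀ τ : Op Y q, spinPartialTrace ε.symm.toEmbedding τ = reindexOp ε τ := fun τ => by
    rw [spinPartialTrace_equiv, Equiv.symm_symm]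
  have hσ'psd : ∀ g, (σ' g).PosSemidef := fun g => by
    show (reindexOp ε (σ g)).PosSemidef
    rw [← hre]; exact posSemidef_spinPartialTrace _ (hσ g)
  have hσ'tr : ∀ g, (σ' g).trace = 1 := fun g => by
    show (reindexOp ε (σ g)).trace = 1
    rw [trace_reindexOp, htr]
  have eK : ∀ τ : Op Y q, spinPartialTrace φK τ =
      spinPartialTrace (Function.Embedding.inl : K ↪ K ⊕ C) (reindexOp ε τ) := fun τ => by
    rw [hK, spinPartialTrace_trans, hre]
  have hσ'pos : ∀ g, 0 ≤ vonNeumannEntropy (σ' g) -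
      vonNeumannEntropy (spinPartialTrace (Function.Embedding.inl : K ↪ K ⊕ C) (σ' g)) := fun g => by
    show 0 ≤ vonNeumannEntropy (reindexOp ε (σ g)) -
      vonNeumannEntropy (spinPartialTrace (Function.Embedding.inl : K ↪ K ⊕ C) (reindexOp ε (σ g)))
    rw [vonNeumannEntropy_reindexOp ε (hσ g).1, ← eK]
    exact hpos g
  have key := entropy_sub_spinPartialTrace_inl_avg_nonneg σ' hσ'psd hσ'tr hσ'pos
  have hbar : reindexOp ε ((Fintype.card G : ℂ)⁻¹ • ∑ g, σ g) = (Fintype.card G : ℂ)⁻¹ • ∑ g, σ' g := by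
    simp only [hσ', map_smul, map_sum]
  have hpsd : ((Fintype.card G : ℂ)⁻¹ • ∑ g, σ g).PosSemidef := by
    have hN : (0 : ℂ) ≤ (Fintype.card G : ℂ)⁻¹ := by
      rw [← Complex.ofReal_natCast, ← Complex.ofReal_inv]
      exact Complex.zero_le_real.mpr (inv_nonneg.mpr (Nat.cast_nonneg _))
    exact (Matrix.posSemidef_sum Finset.univ fun g _ => hσ g).smul hN
  rw [eK, hbar, ← vonNeumannEntropy_reindexOp ε hpsd.1, hbar]
  exact key

end Literature.MathematicalPhysics.QuantumLattice
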